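import Summits.QuantumFields.YangMills.Theorems.PencilRigidityDiagonalMirrorRPRStubRpClosure

/-!
# Crux `DiagonalMirrorRPR` (stmt-QuantumFields-10604), line `parity-bridge-cold-traces`: the stub
# `stub_rpClosureOffDiag` (S4', the closure step from the NARROWED cover insensitivity)

The registered stub `stub_rpClosureOffDiag : RPClosureOffDiag` of the skeleton
`Cruxes/DiagonalMirrorRPR/Lines/parity_bridge_cold_traces.lean` (crux `DiagonalMirrorRPR`, stmt-QuantumFields-10604,
routes `PencilRigidity` = `MirrorModularBoosts`), the lead's reshape of the landed S4 `stub_rpClosure`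
(`…StubRpClosure`): the same OS-limit bookkeeping, but consuming cover insensitivity only on compactly supported real
families with PAIRWISE DISJOINT supports (`CoverInsensitivityOffDiag`, §3b of the skeleton, declared here VERBATIM
together with the statement `RPClosureOffDiag` and the two comparison lemmas, same namespace, so the registered
signature elaborates unchanged).

Why the narrowing costs nothing.  The landed proof invokes cover insensitivity exactly once (`RpClosure.psd_canonical`),
on the frame-rotated real factors `gR = (f ↦ f ∘ R⁻¹) ∘ ((Θ f_{I,·})ʳᵉᵛ ++ f_{J,·})` of `Θ P_I* ⊗ P_J` for slab-ordered
compact products `P_I`, `P_J`; `append_slabs` puts the un-rotated factors in pairwise ORDERED closed time slabs, so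
their supports are pairwise disjoint, and `supp (g ∘ R⁻¹) ⊆ R (supp g)` keeps them disjoint
(`disjoint_tsupport_linActTest_of_slabs`).  The rest of the chain is copied with only this plumbing changed:
`psd_canonical_offDiag` → `psd_frame_offDiag` → `isReflectionPositive_pullback_offDiag` → `stub_rpClosureOffDiag`;
all lattice, support, frame and density lemmas are the landed ones (`…StubRpClosureDefs/Lattice/Support/Density`,
`…StubRpClosure`), used by reference.  `RPClosureOffDiag.rpClosure` records that S4' implies the landed S4.

References: Osterwalder–Schrader, Comm. Math. Phys. 31 (1973) §2–3 (E2 on `𝒮_<`); Glimm–Jaffe, *Quantum Physics*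
§6.1; Fröhlich–Israel–Lieb–Simon, Comm. Math. Phys. 62 (1978) Thm 2.1; Osterwalder–Seiler, Ann. Phys. 110 (1978) §2.
-/

set_option autoImplicit false

noncomputable section

open scoped SchwartzMap ComplexConjugate InnerProductSpace
open MeasureTheory Filter Topology
open Literature.MathematicalPhysics.QuantumLattice Literature.MathematicalPhysics.AQFT
  Literature.MathematicalPhysics.QuantumFieldTheory

namespace Summit.QuantumFields.YangMills.Cruxes.DiagonalMirrorRPR.ParityBridgeColdTraces

/-! ## §3b Cover insensitivity on OFF-DIAGONAL compactly supported real families (verbatim from the skeleton) -/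

section OffDiag

variable {G : Type} [Group G] [TopologicalSpace G] [IsTopologicalGroup G] [CompactSpace G]
  [MeasurableSpace G] [BorelSpace G]

/-- **Cover insensitivity on off-diagonal families**: for compactly supported real test functions with PAIRWISE
DISJOINT supports, the curvature strings computed on the statement's torus `ℤ⁴/N_kℤ⁴` and on its 45° double cover
have the same limit behaviour (difference `→ 0`). -/
def CoverInsensitivityOffDiag (r : LatticeRep G) (sch : SpeciesScheme (YMSpecies G)) : Prop :=
  ∀ (n : ℕ), n ≠ 0 → ∀ (f : Fin n → 𝓢(E4, ℝ)), (∀ i, HasCompactSupport (f i)) →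
    (∀ i j, i ≠ j → Disjoint (tsupport (f i : E4 → ℝ)) (tsupport (f j : E4 → ℝ))) →
    Tendsto (fun k : ℕ => latticeSchwinger r.ρ sch (fun s => s.F) k n (fun _ => r.curvature) f -
      coverSchwinger r sch k n f) atTop (𝓝 0)

/-- The typed `CoverInsensitivity` implies the narrowed one (forget the disjointness hypothesis). -/
theorem CoverInsensitivity.offDiag {r : LatticeRep G} {sch : SpeciesScheme (YMSpecies G)}
    (h : CoverInsensitivity r sch) : CoverInsensitivityOffDiag r sch :=
  fun n hn f hcs _ => h n hn f hcs

end OffDiag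

/-! ## §5' The registered stub statement (verbatim from the skeleton) -/

/-- Statement of `stub_rpClosureOffDiag` (S4', the reshaped S4): the closure step from the NARROWED cover
insensitivity. -/
def RPClosureOffDiag : Prop :=
  ∀ (G : Type) [Group G] [TopologicalSpace G] [IsTopologicalGroup G] [CompactSpace G]
    [MeasurableSpace G] [BorelSpace G], IsCompactSimpleLieGroup G →
    ∀ (r : LatticeRep G) (sch : SpeciesScheme (YMSpecies G)) (S₁ : SchwingerFamily E4),
      CurvaturePackage r sch S₁ → (∀ k, 0 ≤ sch.β k) →
        (∀ k, 2 ≤ sch.side k → CoverSwapRPAt r.ρ (sch.β k) (sch.side k)) →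
          CoverInsensitivityOffDiag r sch → DiagonalFrameRP S₁

/-- The reshaped S4' implies the typed S4 (so S4' is the stronger closure theorem). -/
theorem RPClosureOffDiag.rpClosure (h : RPClosureOffDiag) : RPClosure :=
  fun G _ _ _ _ _ _ hG r sch S₁ hW hβ hRP hCI => h G hG r sch S₁ hW hβ hRP hCI.offDiag

/-! # Proof material (sub-namespace `RpClosure`, new names next to the landed S4 lemmas) -/

namespace RpClosure

/-! ## §E' Disjoint supports of frame-rotated slab families -/

section Slabs

/-- Support of `f ∘ L⁻¹`: a point of `supp (f ∘ L⁻¹)` is mapped by `L⁻¹` into `supp f`. -/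
theorem tsupport_linActTest_subset (L : E4 ≃ₗᵢ[ℝ] E4) (f : 𝓢(E4, ℝ)) :
    tsupport (linActTest L f : E4 → ℝ) ⊆ L.symm ⁻¹' tsupport (f : E4 → ℝ) := by
  have hfun : (linActTest L f : E4 → ℝ) = (f : E4 → ℝ) ∘ L.symm := by
    funext z; rfl
  rw [hfun]
  exact tsupport_comp_subset_preimage (f : E4 → ℝ) L.symm.continuous

/-- **Pairwise ordered slabs stay disjoint in a frame.** If the real test functions `g p` are supported in pairwise
ordered closed time slabs `{lo_p ≤ x⁰ ≤ hi_p}`, `hi_p < lo_q` for `p < q`, then the frame-rotated functions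
`g p ∘ L⁻¹` have pairwise disjoint supports. -/
theorem disjoint_tsupport_linActTest_of_slabs {k : ℕ} {g : Fin k → 𝓢(E4, ℝ)} {lo hi : Fin k → ℝ}
    (hord : ∀ p q, p < q → hi p < lo q)
    (hsupp : ∀ p, tsupport (g p : E4 → ℝ) ⊆ {x | lo p ≤ x 0 ∧ x 0 ≤ hi p}) (L : E4 ≃ₗᵢ[ℝ] E4)
    (p q : Fin k) (hpq : p ≠ q) :
    Disjoint (tsupport (linActTest L (g p) : E4 → ℝ)) (tsupport (linActTest L (g q) : E4 → ℝ)) := by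
  -- adapted from `isOffDiagonal_of_slabs` (…StubRpClosureSupport §E)
  refine Set.disjoint_left.2 fun x hxp hxq => ?_
  have hp := hsupp p (tsupport_linActTest_subset L (g p) hxp)
  have hq := hsupp q (tsupport_linActTest_subset L (g q) hxq)
  rcases lt_or_gt_of_ne hpq with h | h
  · have := hord p q h; linarith [hp.2, hq.1]
  · have := hord q p h; linarith [hp.1, hq.2]

end Slabs

/-! ## §H' Positivity of the limiting quadratic form, from the narrowed cover insensitivity -/

section PSD

variable {G : Type} [Group G] [TopologicalSpace G] [IsTopologicalGroup G] [CompactSpace G]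
  [MeasurableSpace G] [BorelSpace G] (r : LatticeRep G) (sch : SpeciesScheme (YMSpecies G))
  {R : E4 ≃ₗᵢ[ℝ] E4} {c : ℝ}

/-- **(PSD) in a canonical frame, narrowed hypothesis.** For `R e₀ = c (e₀ − e₁)`, `c = 1/√2`, every finite family
of slab-ordered compact real products `P_I` and coefficients `c_I`: `∑_{I,J} c̄_I c_J 𝔖(R · (Θ P_I* ⊗ P_J)) ≥ 0`.
Same proof as `psd_canonical`; cover insensitivity is only used on the frame-rotated factors of `Θ P_I* ⊗ P_J`,
whose supports are pairwise disjoint (`disjoint_tsupport_linActTest_of_slabs`). -/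
theorem psd_canonical_offDiag (S₁ : SchwingerFamily E4) (hW : CurvaturePackage r sch S₁)
    (hRP : ∀ k, 2 ≤ sch.side k → CoverSwapRPAt r.ρ (sch.β k) (sch.side k)) (hCI : CoverInsensitivityOffDiag r sch)
    (hc : c ^ 2 = 1 / 2) (hc0 : 0 < c) (hR : R (ee 0) = c • ee 0 + (-c) • ee 1) {ι : Type} [Fintype ι]
    (deg : ι → ℕ) (P : (I : ι) → 𝓢((Fin (deg I) → E4), ℂ))
    (hP : ∀ I, P I ∈ slabOrderedCompactProducts 4 (deg I)) (coef : ι → ℂ) :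
    let z := ∑ I, ∑ J, conj (coef I) * coef J * (pullback S₁ R).osPairing (P I) (P J)
    0 ≤ z.re ∧ z.im = 0 := by
  -- adapted from `psd_canonical` (…StubRpClosure §H): only the `hCI` plumbing changes
  intro z
  haveI : SecondCountableTopology G :=
    (r.continuous.isClosedEmbedding r.injective).isEmbedding.secondCountableTopology
  obtain ⟨hconv, ⟨hE0, -, -, -, -, -⟩, -, -, -⟩ := hW
  choose f lo hi hT hlo hle hord hsupp hcs using hP
  obtain ⟨ϱ, hϱ⟩ := exists_radius r.curvature.supp
  -- the lattice observables `A_I^k = ∏_l Φ̃_k(f_{I,l} ∘ R⁻¹)`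
  let A : (k : ℕ) → ι → TConfig (2 * sch.side k) (sch.side k) (sch.side k) G → ℝ :=
    fun k I U => ∏ l, coverField r sch k (linActTest R (f I l)) U
  have hAobs : ∀ k I, Measurable (A k I) ∧ ∃ C : ℝ, ∀ U, |A k I U| ≤ C := fun k I =>
    prod_observable _ (fun l => measurable_coverField r sch k _) fun l => exists_abs_coverField_le r sch k _
  -- eventually they live on the closed positive half
  have hAdep : ∀ᶠ k in atTop, ∀ I, DependsOn (A k I) (posEdges (sch.side k)) := by
    have hev : ∀ I (l : Fin (deg I)), ∀ᶠ k in atTop, sch.a k * (c * (2 * ϱ + 1)) < lo I l ∧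
        hi I l < c * sch.a k * (2 * (sch.L k : ℝ) - 2 * ϱ - 1) := fun I l =>
      (eventually_a_mul_lt sch _ (hlo I l)).and (eventually_lt_window sch hc0 ϱ (hi I l))
    have hev' : ∀ᶠ k in atTop, ∀ I (l : Fin (deg I)), sch.a k * (c * (2 * ϱ + 1)) < lo I l ∧
        hi I l < c * sch.a k * (2 * (sch.L k : ℝ) - 2 * ϱ - 1) :=
      Filter.eventually_all.2 fun I => Filter.eventually_all.2 fun l => hev I l
    filter_upwards [hev'] with k hk I
    refine dependsOn_prod _ fun l => ?_
    exact dependsOn_smearedLatticeField r.curvature hϱ _ _ _ _ _ fun x _ hne =>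
      sheared_range_of_ne_zero hR hc0 (hsupp I l) (sch.a_pos k) (hk I l).1 (hk I l).2 x hne
  -- the closed target set
  let C : Set ℂ := {w | 0 ≤ w.re ∧ w.im = 0}
  have hCcl : IsClosed C :=
    (isClosed_le continuous_const Complex.continuous_re).inter (isClosed_eq Complex.continuous_im continuous_const)
  -- entry convergence
  have hentry : ∀ I J, Tendsto (fun k => texp r.ρ (sch.β k) true
      (fun U => ((A k I (swapConfig U) * A k J U : ℝ) : ℂ))) atTop (𝓝 ((pullback S₁ R).osPairing (P I) (P J))) := by
    intro I J
    -- the real factors of `Θ P_I* ⊗ P_J` and their rotated versions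
    let g : Fin (deg I + deg J) → 𝓢(E4, ℝ) := Fin.append (fun i => thetaTest 4 (f I (Fin.rev i))) (f J)
    let gR : Fin (deg I + deg J) → 𝓢(E4, ℝ) := fun p => linActTest R (g p)
    have hTg : IsTensorOf ((osAdjoint (P I)).appendTensor (P J)) fun p => ofRealTest (g p) :=
      isTensorOf_osAdjoint_appendTensor (hT I) (hT J)
    have hTgR : IsTensorOf (linActMulti R ((osAdjoint (P I)).appendTensor (P J))) fun p => ofRealTest (gR p) :=
      hTg.linActMulti R
    obtain ⟨LO, HI, -, hord', hsupp'⟩ :=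
      append_slabs (hlo I) (hle I) (hord I) (hsupp I) (hlo J) (hle J) (hord J) (hsupp J)
    have hoffR : IsOffDiagonal (linActMulti R ((osAdjoint (P I)).appendTensor (P J))) :=
      isOffDiagonal_linActMulti (isOffDiagonal_of_slabs hTg hord' hsupp') R
    -- NEW: the rotated factors have pairwise disjoint supports
    have hdisjR : ∀ p q, p ≠ q → Disjoint (tsupport (gR p : E4 → ℝ)) (tsupport (gR q : E4 → ℝ)) :=
      fun p q hpq => disjoint_tsupport_linActTest_of_slabs hord' hsupp' R p q hpq
    have hcsg : ∀ p, HasCompactSupport (g p : E4 → ℝ) := fun p => by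
      induction p using Fin.addCases with
      | left i => simp only [g, Fin.append_left]; exact hasCompactSupport_thetaTest (hcs I _)
      | right j => simp only [g, Fin.append_right]; exact hcs J j
    have hcsR : ∀ p, HasCompactSupport (gR p : E4 → ℝ) := fun p => hasCompactSupport_linActTest (hcsg p) R
    -- the cover Gram entry is the cover Schwinger function of the rotated factors
    have hprod : ∀ k U, ∏ p, coverField r sch k (gR p) U = A k I (swapConfig U) * A k J U := by
      intro k U
      rw [Fin.prod_univ_add]
      simp only [gR, g, Fin.append_left, Fin.append_right, A]
      congr 1
      simp only [coverField_thetaTest r sch hR hc]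
      exact Fintype.prod_equiv Fin.revPerm _ _ fun i => by simp
    have hident : ∀ k, texp r.ρ (sch.β k) true (fun U => ((A k I (swapConfig U) * A k J U : ℝ) : ℂ)) =
        ((coverSchwinger r sch k (deg I + deg J) gR : ℝ) : ℂ) := by
      intro k
      rw [texp_ofReal_eq_re, coverSchwinger_eq]
      simp only [hprod]
    simp only [hident, pullback_osPairing]
    by_cases hn : deg I + deg J = 0
    · -- degree zero: both sides are `1`
      haveI : IsEmpty (Fin (deg I + deg J)) := by rw [hn]; infer_instance
      have hdI : deg I = 0 := by omega
      have hdJ : deg J = 0 := by omega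
      haveI : IsEmpty (Fin (deg I)) := by rw [hdI]; infer_instance
      haveI : IsEmpty (Fin (deg J)) := by rw [hdJ]; infer_instance
      have hlim : S₁ (deg I + deg J) (linActMulti R ((osAdjoint (P I)).appendTensor (P J))) = 1 := by
        have hgen : ∀ {m : ℕ} (hm : m = 0) (F : 𝓢((Fin m → E4), ℂ)) (x : Fin m → E4), S₁ m F = F x := by
          intro m hm F x
          subst hm
          exact (hE0 (fun _ => ()) F).trans (congrArg F (Subsingleton.elim _ _))
        rw [hgen hn _ (fun _ => 0), hTgR]
        simp
      have hcov : ∀ k, coverSchwinger r sch k (deg I + deg J) gR = 1 := fun k => by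
        rw [coverSchwinger_eq]
        simp only [Finset.univ_eq_empty, Finset.prod_empty, Complex.ofReal_one]
        rw [texp_one r.ρ _ _ r.continuous, Complex.one_re]
      simp only [hlim, hcov, Complex.ofReal_one]
      exact tendsto_const_nhds
    · have h1 := hconv (deg I + deg J) hn gR _ hTgR hoffR
      have h2 := hCI (deg I + deg J) hn gR hcsR hdisjR
      have h3 : Tendsto (fun k => ((latticeSchwinger r.ρ sch (fun s => s.F) k (deg I + deg J)
          (fun _ => r.curvature) gR : ℝ) : ℂ) - (((latticeSchwinger r.ρ sch (fun s => s.F) k (deg I + deg J)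
          (fun _ => r.curvature) gR - coverSchwinger r sch k (deg I + deg J) gR : ℝ)) : ℂ)) atTop
          (𝓝 (S₁ (deg I + deg J) (linActMulti R ((osAdjoint (P I)).appendTensor (P J))) - ((0 : ℝ) : ℂ))) :=
        h1.sub ((Complex.continuous_ofReal.tendsto 0).comp h2)
      simp only [Complex.ofReal_zero, sub_zero] at h3
      refine h3.congr fun k => ?_
      push_cast
      ring
  -- assembling: the lattice Gram forms converge to `z` and are eventually in `C`
  have hlim : Tendsto (fun k => ∑ I, ∑ J, conj (coef I) * coef J *
      texp r.ρ (sch.β k) true (fun U => ((A k I (swapConfig U) * A k J U : ℝ) : ℂ))) atTop (𝓝 z) :=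
    tendsto_finsetSum _ fun I _ => tendsto_finsetSum _ fun J _ => (hentry I J).const_mul _
  have hev : ∀ᶠ k in atTop, (∑ I, ∑ J, conj (coef I) * coef J *
      texp r.ρ (sch.β k) true (fun U => ((A k I (swapConfig U) * A k J U : ℝ) : ℂ))) ∈ C := by
    filter_upwards [eventually_two_le_side sch, hAdep] with k hk hdep
    exact lattice_psd r (sch.β k) (sch.side k) (hRP k hk) (A k) (fun I => (hAobs k I).1)
      (fun I => (hAobs k I).2) hdep coef
  exact hCcl.mem_of_tendsto hlim hev

end PSD

/-! ## §I' Frame reduction and the closure argument, from the narrowed cover insensitivity -/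

section Closure

variable {G : Type} [Group G] [TopologicalSpace G] [IsTopologicalGroup G] [CompactSpace G]
  [MeasurableSpace G] [BorelSpace G] (r : LatticeRep G) (sch : SpeciesScheme (YMSpecies G))
  (S₁ : SchwingerFamily E4)

/-- **(PSD) in every diagonal frame, narrowed hypothesis**: reduce `R` to a canonical frame by a proper sign flip
`P` (the package's `W(B₄)`-invariance on `⁰𝒮`: `𝔖(PR · G) = 𝔖(R · G)` for the off-diagonal `G = Θ P_I* ⊗ P_J`),
then `psd_canonical_offDiag`. -/
theorem psd_frame_offDiag (hW : CurvaturePackage r sch S₁)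
    (hRP : ∀ k, 2 ≤ sch.side k → CoverSwapRPAt r.ρ (sch.β k) (sch.side k)) (hCI : CoverInsensitivityOffDiag r sch)
    {R : E4 ≃ₗᵢ[ℝ] E4} {a b : ℝ} (ha : a ^ 2 = 1 / 2) (hb : b ^ 2 = 1 / 2)
    (hR : R (ee 0) = a • ee 0 + b • ee 1) {ι : Type} [Fintype ι] (deg : ι → ℕ)
    (P : (I : ι) → 𝓢((Fin (deg I) → E4), ℂ)) (hP : ∀ I, P I ∈ slabOrderedCompactProducts 4 (deg I))
    (coef : ι → ℂ) :
    let z := ∑ I, ∑ J, conj (coef I) * coef J * (pullback S₁ R).osPairing (P I) (P J)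
    0 ≤ z.re ∧ z.im = 0 := by
  -- adapted from `psd_frame` (…StubRpClosure §I)
  intro z
  obtain ⟨Pf, c, hc, hc0, hdet, hsigned, hR'⟩ := frame_normal_form ha hb hR
  have hrot := hW.2.2.2.1
  have hterm : ∀ I J, (pullback S₁ R).osPairing (P I) (P J) =
      (pullback S₁ (R.trans Pf)).osPairing (P I) (P J) := by
    intro I J
    obtain ⟨fI, loI, hiI, hTI, hloI, hleI, hordI, hsuppI, -⟩ := hP I
    obtain ⟨fJ, loJ, hiJ, hTJ, hloJ, hleJ, hordJ, hsuppJ, -⟩ := hP J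
    obtain ⟨LO, HI, -, hord', hsupp'⟩ := append_slabs hloI hleI hordI hsuppI hloJ hleJ hordJ hsuppJ
    have hoff : IsOffDiagonal ((osAdjoint (P I)).appendTensor (P J)) :=
      isOffDiagonal_of_slabs (isTensorOf_osAdjoint_appendTensor hTI hTJ) hord' hsupp'
    rw [pullback_osPairing, pullback_osPairing,
      ← Summit.QuantumFields.YangMills.Theorems.DiagonalMirrorRPR.Negative.Phantom.linActMulti_linActMulti Pf R,
      hrot Pf hdet hsigned _ _ (isOffDiagonal_linActMulti hoff R)]
  simp only [z, hterm]
  exact psd_canonical_offDiag r sch S₁ hW hRP hCI hc hc0 hR' deg P hP coef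

/-- **The closure step, narrowed hypothesis.** Exact swap-RP upstairs + cover insensitivity on off-diagonal
families + `hconv` + E0 + continuity + the density of slab-ordered compact real products in the time-ordered test
functions ⇒ the pulled-back family is reflection positive (E2) in the diagonal frame `R`. -/
theorem isReflectionPositive_pullback_offDiag (hW : CurvaturePackage r sch S₁)
    (hRP : ∀ k, 2 ≤ sch.side k → CoverSwapRPAt r.ρ (sch.β k) (sch.side k)) (hCI : CoverInsensitivityOffDiag r sch)
    {R : E4 ≃ₗᵢ[ℝ] E4} {a b : ℝ} (ha : a ^ 2 = 1 / 2) (hb : b ^ 2 = 1 / 2)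
    (hR : R (ee 0) = a • ee 0 + b • ee 1) :
    (SchwingerFamily.toLabelled (fun n => (S₁ n).comp (linActMulti R))).IsReflectionPositive := by
  -- adapted from `isReflectionPositive_pullback` (…StubRpClosure §I), itself adapted from
  -- `IsSchwingerFamilyOf.isOSReflectionPositive_of_closure` (Literature/QuantumLattice/SchwingerOSPositivity)
  intro N deg lab F hF H hH z
  let S : SchwingerFamily E4 := pullback S₁ R
  let Φ : ((j : Fin N) → 𝓢((Fin (deg j) → E4), ℂ)) → ℂ := fun G => ∑ i, ∑ j, S.osPairing (G i) (G j)
  have hΦ : Continuous Φ := by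
    refine continuous_finsetSum _ fun i _ => continuous_finsetSum _ fun j _ => ?_
    exact continuous_iff_continuousAt.2 fun G =>
      S.tendsto_osPairing ((continuous_apply i).tendsto G) ((continuous_apply j).tendsto G)
  let C : Set ℂ := {w | 0 ≤ w.re ∧ w.im = 0}
  have hC : IsClosed C :=
    (isClosed_le continuous_const Complex.continuous_re).inter
      (isClosed_eq Complex.continuous_im continuous_const)
  let A : Set ((j : Fin N) → 𝓢((Fin (deg j) → E4), ℂ)) :=
    Set.pi Set.univ fun j => (Submodule.span ℂ (slabOrderedCompactProducts 4 (deg j)) : Set _)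
  have hA : A ⊆ Φ ⁻¹' C := by
    intro G hG
    have hrep : ∀ j : Fin N, ∃ (k : ℕ) (cf : Fin k → ℂ) (v : Fin k → slabOrderedCompactProducts 4 (deg j)),
        ∑ i, cf i • (v i : 𝓢((Fin (deg j) → E4), ℂ)) = G j :=
      fun j => Submodule.mem_span_set'.1 (hG j (Set.mem_univ j))
    choose k cf v hv using hrep
    have key := psd_frame_offDiag r sch S₁ hW hRP hCI ha hb hR (ι := Σ j : Fin N, Fin (k j))
      (fun p => deg p.1) (fun p => (v p.1 p.2 : 𝓢((Fin (deg p.1) → E4), ℂ))) (fun p => (v p.1 p.2).2)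
      (fun p => cf p.1 p.2)
    have hΦG : Φ G = ∑ p : (Σ j : Fin N, Fin (k j)), ∑ q : (Σ j : Fin N, Fin (k j)),
        conj (cf p.1 p.2) * cf q.1 q.2 *
          S.osPairing (v p.1 p.2 : 𝓢((Fin (deg p.1) → E4), ℂ)) (v q.1 q.2 : 𝓢((Fin (deg q.1) → E4), ℂ)) := by
      simp only [Φ, ← hv]
      simp only [Fintype.sum_sigma]
      refine Finset.sum_congr rfl fun n _ => ?_
      rw [Finset.sum_comm]
      refine Finset.sum_congr rfl fun m _ => ?_
      have := S.osPairing_sum_smul Finset.univ Finset.univ (cf n) (cf m)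
        (fun i => (v n i : 𝓢((Fin (deg n) → E4), ℂ))) (fun i => (v m i : 𝓢((Fin (deg m) → E4), ℂ)))
      rw [this]
    show Φ G ∈ C
    rw [hΦG]
    exact key
  have hcl : closure A ⊆ Φ ⁻¹' C := (hC.preimage hΦ).closure_subset_iff.2 hA
  have hFmem : (fun j : Fin N => F j) ∈ closure A := by
    rw [closure_pi_set]
    exact fun j _ => mem_closure_span_slabOrderedCompactProducts (hF j)
  have hres : Φ (fun j => F j) ∈ C := hcl hFmem
  have hz : z = Φ (fun j => F j) := by
    simp only [z, Φ, SchwingerFamily.toLabelled_apply]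
    refine Finset.sum_congr rfl fun i _ => Finset.sum_congr rfl fun j _ => ?_
    exact S.osPairing_eq_of_isAppendTensorOf (hH i j)
  rw [hz]
  exact hres

end Closure

end RpClosure

/-- **S4' (M), `stub_rpClosureOffDiag`.** Closure from the NARROWED cover insensitivity: exact RP upstairs
(`CoverSwapRPAt` at `N_k ≥ 2`) + `CoverInsensitivityOffDiag` + `hconv` (all degrees, test function by test function)
+ E0 (degree `0`) + continuity of `S₁ n` + density of finite sums of slab-ordered COMPACT real tensors in the rotated
wedge classes ⇒ `DiagonalFrameRP S₁`.  Same proof as the landed S4: the only families on which cover insensitivity is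
invoked are the frame-rotated factors of `Θ P_I* ⊗ P_J` for slab-ordered compact products, whose supports are pairwise
disjoint. -/
theorem stub_rpClosureOffDiag :
    ∀ (G : Type) [Group G] [TopologicalSpace G] [IsTopologicalGroup G] [CompactSpace G]
      [MeasurableSpace G] [BorelSpace G], IsCompactSimpleLieGroup G →
      ∀ (r : LatticeRep G) (sch : SpeciesScheme (YMSpecies G)) (S₁ : SchwingerFamily E4),
        CurvaturePackage r sch S₁ → (∀ k, 0 ≤ sch.β k) →
          (∀ k, 2 ≤ sch.side k → CoverSwapRPAt r.ρ (sch.β k) (sch.side k)) →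
            CoverInsensitivityOffDiag r sch → DiagonalFrameRP S₁ := by
  intro G _ _ _ _ _ _ _hG r sch S₁ hW _hβ hRP hCI R a b ha hb hR
  exact RpClosure.isReflectionPositive_pullback_offDiag r sch S₁ hW hRP hCI ha hb hR

/-- The registered short form `RPClosureOffDiag` holds. -/
theorem RpClosure.rpClosureOffDiag : RPClosureOffDiag := stub_rpClosureOffDiag

end Summit.QuantumFields.YangMills.Cruxes.DiagonalMirrorRPR.ParityBridgeColdTraces

end
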